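/-
Copyright (c) 2026 the pub-hodgecm-mathlib formalisation cell (harness21).  Prover seat hodgecm-mathlib-K2E1-p16 (g0), Track B ∕ K2-LIT, h413 = `stmt-HodgeConjecture-24833`,
line `K2_E1_TraceFormulaBeta`, route of record `HCCMUnconditional`; dealer K2E1-plan (g7) (272): G6-inst FILE 1 of ROADCARD 5Res AMENDMENT #3 «GENERAL (U,τ) LADDER» — the LEVEL∕ω
edition of ★ p860653 `K2E1ChiScatteringRealPolesOfModelM1CMTwo`: the entry letter `hs` for the scattering COORDINATES of a self-dual unitary `χ` at ANY level, the rank-one (FE)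
device on the unitary axis replaced by the axis letter in analyticity form (matrix currency, `dim V(χ, K′, ω) ≥ 1`).
-/
import Summits.HodgeConjecture.HodgeConjecture.Theorems.K2E1ChiScatteringRealPolesOfModelM1CMTwo      -- ★ p860653 (K2E1-p13): `chi_scattering_hreal_of_model_m1_cm_two` (level-generic); brings ★ `K2E1MeromorphicStripFinitePoles`
import HarnessLib

/-!
# K2·E1 — `K2E1ChiScatteringRealPolesOfModelLevelCMTwo`: `hreal` AND THE ENTRY LETTER `hs` FOR THE SCATTERING COORDINATES OF A SELF-DUAL UNITARY `χ` OF `U(1,1)_{L∕L⁺}` AT A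
# GENERAL LEVEL `(K′, ω)` — ★ p860653 with the rank-one (FE) letter replaced by the AXIS letter `haxis` (no pole on `Re z = ½`, analyticity form), per entry, per column, and for
# the whole matrix (ONE finset of real poles, ONE open neighbourhood of the half-strip)

Track B ∕ K2-LIT, crux h413 = `stmt-HodgeConjecture-24833`; cell `hodgecm-mathlib`, squad K2, ENGINE E1, campaign «5Res», AMENDMENT #3 rung G6 («`hreal ∧ hs` at general `(U,τ)`»).
THEOREMS ONLY (no `def`, no `instance`, no notation, no named-fact hypothesis, no `sorry`; default heartbeats); lane `--kind proof --supports stmt-HodgeConjecture-24833 --as helper`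
(count-neutral).  Closes no socket.

CENSUS (this seat, bus `K2/STATUS.md` 14:26Z).  ★ p860653's heads `chi_scattering_noComplexPole_of_model_m1_cm_two` ∕ `chi_scattering_hreal_of_model_m1_cm_two` carry NO level token
(their `μK` is the Haar measure of `K_max`, ★ B2's Iwasawa pairing slice, the right slice at EVERY level since `G(𝔸) = B(𝔸)·K_max`; `hφ : IsChiSection χ φ` and the basis functions `b j`
are plain): they are used here BY NAME, not restated.  The ONE rank-one letter of ★ p860653 is the entrywise scalar functional equation `hFE : qc_j(z)·qc_j(1−z) = 1` of its `hs` head —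
true at M1 (`dim V(χ, K_max, 1) = 1`), false in general at a level with `dim V(χ, K′, ω) > 1`, where the functional equation is the MATRIX identity `M(z)M(1−z) = 1` (★ G8
`K2E1SpanOperatorMatrixLetters.hFE_of_coords`); ★ p860653 uses it only to exclude poles ON the unitary axis (★ `analyticAt_of_re_eq_half_of_fe_of_conj`).  THE LEVEL EDITION therefore
takes the axis letter in ANALYTICITY form, `haxis : ∀ j z, z.re = ½ → AnalyticAt ℂ (qc j) z` (payer at `dim V > 1`: the matrix axis file `K2E1ChiScatteringMatrixAxisNoPoleU2`
`analyticAt_coord_of_re_eq_half` ⟸ matrix FE + K-pairing adjointness; at M1: ★ `analyticAt_of_re_eq_half_of_fe_of_conj`), and concludes through ★ GENERIC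
`K2E1MeromorphicStripFinitePoles.exists_finset_differentiableOn_strip_of_singular`.

THE MATHEMATICS ([MoeglinWaldspurger1995, IV.1.11, IV.3.12 (a)]; [BernsteinLapid2019, Thm 2.3, §4]; [Arthur1980TraceFormulaII, §4]).  For a self-dual unitary `χ` and a `χ`-section `φ`
(any level, any `K_∞`-type) with scattering coordinates `qc_j` (continued, analytic off a closed co-discrete `P ⊆ {Re ≤ 1}`) the χ-Maass–Selberg relation in the `L²(K_max)`-model (★ B2,
paid ball by ball on the truncated families of the SAME `Ec`) forces every genuine pole of `qc_j` with `½ < Re z ≤ σ₀` to be REAL with `Re z < σ₀` (★ `chi_scattering_hreal_of_model_m1_cm_two`);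
with NO pole on `Re z = ½` (`haxis`) the singular set of `qc_j` in the CLOSED half-strip `{½ ≤ Re ≤ σ₀}` is a finite set of reals in `(½, σ₀)` (co-discrete ∩ compact), whence a finset
`S ⊂ (½, σ₀)` and an open `U′ ⊇ {½ ≤ Re ≤ σ₀}` with `qc_j` holomorphic on `U′ ∖ S`.  For finitely many functions (all entries `j` of one column, or all entries `(a, j)` of the
matrix over the columns `φ_a` of a basis of `V(χ, K′, ω)`, each column with ITS OWN package and pole set `P_a`) one takes the union of the finsets and the (finite) intersection of the
opens: ONE `(S, U′)` for the whole matrix — the `hm : ∀ c a, DifferentiableOn ℂ (m · c a) D` currency of ★ `K2E1SpanOperatorMatrixLetters.hs_of_coords` with `D := U′ ∖ ↑S`.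
* §1 (generic, any complete normed `E`) **`exists_finset_differentiableOn_halfStrip_of_axis`** (★ `…_of_fe_of_conj` with (FE)+(conj) ↦ `haxis`) and
  **`exists_finset_differentiableOn_halfStrip_family_of_axis`** (finite family, per-member co-discrete `P_k`, ONE common `(S, U)`).
* §2 (CM, ★ p860653's binders VERBATIM with `hFE` ↦ `haxis`) **`chi_scattering_hs_of_model_level_cm_two`** (per entry `j`; conclusion bytes = ★ p860653's) and
  **`chi_scattering_hs_of_model_level_cm_two_all`** (ONE `(S, U′)` for all entries `j`).
* §3 (CM, columns `a : α`) **`chi_scattering_hs_of_model_level_cm_two_matrix`** (`hreal` for every entry `(a, j)` and ONE `(S, U′)` for the whole matrix).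
REMAINING VISIBLE LETTERS, with named payers at level: the per-column packages and families (★ p860855 `chiEisenstein_meromorphic_exports_level_cm_two` ∕ ★ p860918
`chiEisenstein_family_export_level_cm_two`), `hdec′` per column (level edition of ★ `hdec_maximalLevel_cm_two` — OPEN), `hconj` entrywise (★ G7 p860859∕p860912 on a real `c_G`-stable
basis ★ p860883), `haxis` (K2E1-p15 (g2) `K2E1ChiScatteringMatrixAxisNoPoleU2` ⟸ K2E4-p10's level matrix FE + (KA)), and ★ B1∕B2's structural data.
HONEST LABEL: HC_CM is proved only modulo the 7 printed citations (2 remaining named inputs: hLiu418 = `stmt-HodgeConjecture-24832`, h413 = `stmt-HodgeConjecture-24833`) until rung 0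
closes; this file asserts no named fact, is conditional by construction on its visible binders, and closes no socket.

## References
* [MoeglinWaldspurger1995] C. Mœglin, J.-L. Waldspurger, *Spectral decomposition and Eisenstein series* (1995), IV.1.11, IV.2.3, IV.3.12 (a).
* [BernsteinLapid2019] J. Bernstein, E. Lapid, *On the meromorphic continuation of Eisenstein series*, J. AMS 37 (2024), Thm 2.3, §4.
* [Arthur1980TraceFormulaII] J. Arthur, *A trace formula for reductive groups II*, Compositio Math. 40 (1980), §4.
-/

set_option autoImplicit false
set_option linter.dupNamespace false  -- the mandated namespace repeats the summit's segment (`HodgeConjecture.HodgeConjecture`)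

noncomputable section

open MeasureTheory MeasureTheory.Measure Set NumberField IsDedekindDomain Filter Topology Metric
open scoped NNReal ENNReal ComplexConjugate InnerProductSpace
open Literature.MeasureTheory.Group Literature.NumberTheory
open Literature.NumberTheory.Automorphic Literature.NumberTheory.Automorphic.UnitaryGroup AdelicGroupData
open Literature.NumberTheory.GaloisRepresentations
open Summit.HodgeConjecture.HodgeConjecture.Cruxes.H413.K2E1BorelEisensteinU
open Summit.HodgeConjecture.HodgeConjecture.Cruxes.H413.K2E1CharacterEisensteinU2Defs
open Summit.HodgeConjecture.HodgeConjecture.Cruxes.H413.K2E1MeromorphicStripFinitePoles (exists_finset_differentiableOn_strip_of_singular)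
open Summit.HodgeConjecture.HodgeConjecture.Cruxes.H413.K2E1ChiScatteringRealPolesOfModelM1CMTwo (chi_scattering_hreal_of_model_m1_cm_two)

namespace Summit.HodgeConjecture.HodgeConjecture.Cruxes.H413.K2E1ChiScatteringRealPolesOfModelLevelCMTwo

/-! ## §1 Generic: finitely many real poles in the closed half-strip `{½ ≤ Re ≤ σ₀}` from `hreal` on `½ < Re` and NO pole on the axis (analyticity form) -/

/-- **`hs` ON `{½ ≤ Re ≤ σ₀}` FROM `hreal` AND THE AXIS LETTER** (the level edition of ★ `exists_finset_differentiableOn_halfStrip_of_fe_of_conj`): `f` analytic off a co-discrete `P`,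
every NON-ANALYTIC point with `½ < Re ≤ σ₀` real with `Re < σ₀`, and `f` analytic at every point of the axis `Re = ½` ⇒ a finset `S ⊂ (½, σ₀)` of genuine real poles and an open
`U ⊇ {½ ≤ Re ≤ σ₀}` with `f` holomorphic on `U ∖ ↑S` (★ `exists_finset_differentiableOn_strip_of_singular` with the axis case discharged by `haxis`). [folklore] [cite: MoeglinWaldspurger1995, IV.1.11] -/
theorem exists_finset_differentiableOn_halfStrip_of_axis {E : Type} [NormedAddCommGroup E] [NormedSpace ℂ E] [CompleteSpace E] {f : ℂ → E} {P : Set ℂ}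
    (hPcd : ∀ z₀ : ℂ, ∀ᶠ s in 𝓝[≠] z₀, s ∉ P) (hf : ∀ z : ℂ, z ∉ P → AnalyticAt ℂ f z)
    (haxis : ∀ z : ℂ, z.re = 1 / 2 → AnalyticAt ℂ f z) {σ₀ : ℝ}
    (hreal : ∀ z : ℂ, ¬ AnalyticAt ℂ f z → 1 / 2 < z.re → z.re ≤ σ₀ → z.im = 0 ∧ z.re < σ₀) :
    ∃ (S : Finset ℝ) (U : Set ℂ), (∀ x ∈ S, ¬ AnalyticAt ℂ f (x : ℂ) ∧ 1 / 2 < x ∧ x < σ₀) ∧ IsOpen U ∧ {z : ℂ | 1 / 2 ≤ z.re ∧ z.re ≤ σ₀} ⊆ U ∧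
      DifferentiableOn ℂ f (U \ ((S.image fun x : ℝ => (x : ℂ)) : Set ℂ)) := by
  refine exists_finset_differentiableOn_strip_of_singular hPcd hf fun z hz h1 h2 => ?_
  rcases lt_or_eq_of_le h1 with h | h
  · exact ⟨(hreal z hz h h2).1, h, (hreal z hz h h2).2⟩
  · exact absurd (haxis z h.symm) hz

/-- **ONE `(S, U)` FOR A FINITE FAMILY**: finitely many functions `f k`, each analytic off its own co-discrete `P k`, each with `hreal` on `½ < Re ≤ σ₀` and analytic on the axis ⇒ ONE
finset `S ⊂ (½, σ₀)` of reals (each a genuine pole of SOME `f k`) and ONE open `U ⊇ {½ ≤ Re ≤ σ₀}` with EVERY `f k` holomorphic on `U ∖ ↑S` (union of the finsets, finite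
intersection of the opens of `exists_finset_differentiableOn_halfStrip_of_axis`). [folklore] [cite: MoeglinWaldspurger1995, IV.1.11] -/
theorem exists_finset_differentiableOn_halfStrip_family_of_axis {E : Type} [NormedAddCommGroup E] [NormedSpace ℂ E] [CompleteSpace E]
    {κ : Type} [Fintype κ] {f : κ → ℂ → E} {P : κ → Set ℂ}
    (hPcd : ∀ k (z₀ : ℂ), ∀ᶠ s in 𝓝[≠] z₀, s ∉ P k) (hf : ∀ k (z : ℂ), z ∉ P k → AnalyticAt ℂ (f k) z)
    (haxis : ∀ k (z : ℂ), z.re = 1 / 2 → AnalyticAt ℂ (f k) z) {σ₀ : ℝ}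
    (hreal : ∀ k (z : ℂ), ¬ AnalyticAt ℂ (f k) z → 1 / 2 < z.re → z.re ≤ σ₀ → z.im = 0 ∧ z.re < σ₀) :
    ∃ (S : Finset ℝ) (U : Set ℂ), (∀ x ∈ S, (∃ k, ¬ AnalyticAt ℂ (f k) (x : ℂ)) ∧ 1 / 2 < x ∧ x < σ₀) ∧ IsOpen U ∧ {z : ℂ | 1 / 2 ≤ z.re ∧ z.re ≤ σ₀} ⊆ U ∧
      ∀ k, DifferentiableOn ℂ (f k) (U \ ((S.image fun x : ℝ => (x : ℂ)) : Set ℂ)) := by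
  classical
  choose S U hS hUo hUs hd using fun k => exists_finset_differentiableOn_halfStrip_of_axis (hPcd k) (hf k) (haxis k) (σ₀ := σ₀) (hreal k)
  refine ⟨Finset.univ.biUnion S, ⋂ k, U k, fun x hx => ?_, isOpen_iInter_of_finite hUo, fun z hz => Set.mem_iInter.2 fun k => hUs k hz, fun k => (hd k).mono fun z hz => ?_⟩
  · obtain ⟨k, -, hk⟩ := Finset.mem_biUnion.1 hx
    exact ⟨⟨k, (hS k x hk).1⟩, (hS k x hk).2⟩
  · refine ⟨Set.mem_iInter.1 hz.1 k, fun h => hz.2 ?_⟩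
    rw [Finset.coe_image] at h ⊢
    obtain ⟨x, hx, rfl⟩ := h
    exact ⟨x, Finset.mem_coe.2 (Finset.mem_biUnion.2 ⟨k, Finset.mem_univ _, Finset.mem_coe.1 hx⟩), rfl⟩

/-! ## §2 The level heads, per column: ★ p860653's binders verbatim with `hFE` ↦ `haxis` -/

section Heads

variable (L : Type) [Field L] [NumberField L] [IsCMField L]
variable [MeasurableSpace (quasiSplit (↥(maximalRealSubfield L)) L (IsCMField.complexConj L) 2).Adelic] [BorelSpace (quasiSplit (↥(maximalRealSubfield L)) L (IsCMField.complexConj L) 2).Adelic]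
variable [MeasurableSpace (AdeleRing (𝓞 L) L)ˣ] [BorelSpace (AdeleRing (𝓞 L) L)ˣ]

/-- **`hreal` AND THE ENTRY LETTER `hs` AT A GENERAL LEVEL, PER ENTRY `j`** — ★ p860653 `chi_scattering_hs_of_model_m1_cm_two`'s binders VERBATIM (B1∕B2's structural data, the
self-dual unitary `χ`, a `χ`-section `φ` of ANY level with its meromorphic package and per-ball truncated families of the SAME `Ec`, the `L²(K_max)` classes, `hdec′`, `hPre`, `hconj`)
EXCEPT the rank-one scalar (FE), replaced by the AXIS letter `haxis : ∀ j z, z.re = ½ → AnalyticAt ℂ (qc j) z`; conclusion bytes IDENTICAL with ★ p860653's: `hreal` (★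
`chi_scattering_hreal_of_model_m1_cm_two`, level-generic, by name) and a finset `S ⊂ (½, σ₀)` of genuine real poles with an open `U′ ⊇ {½ ≤ Re ≤ σ₀}` on which `qc j` is holomorphic
off `S`. [cite: MoeglinWaldspurger1995, IV.1.11, IV.3.12 (a)] [cite: BernsteinLapid2019, §4] -/
theorem chi_scattering_hs_of_model_level_cm_two
    (μ : Measure (quasiSplit (↥(maximalRealSubfield L)) L (IsCMField.complexConj L) 2).automorphicQuotient) [(quasiSplit (↥(maximalRealSubfield L)) L (IsCMField.complexConj L) 2).IsAutomorphicMeasure μ]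
    (νG : Measure (quasiSplit (↥(maximalRealSubfield L)) L (IsCMField.complexConj L) 2).Adelic) [νG.IsHaarMeasure] [νG.IsInvInvariant]
    (μK : Measure ((standardMaximalCompactGL 2 L).comap (adelicVal (↥(maximalRealSubfield L)) L (IsCMField.complexConj L) 2 ((StdForm.antidiagonal 2).over L)) : Subgroup (quasiSplit (↥(maximalRealSubfield L)) L (IsCMField.complexConj L) 2).Adelic)) [μK.IsHaarMeasure]
    (νI : Measure (AdeleRing (𝓞 L) L)ˣ) [νI.IsHaarMeasure]
    {𝓕I : Set (AdeleRing (𝓞 L) L)ˣ} (h𝓕I : IsIdeleClassDomain L 𝓕I)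
    (ν : Measure ↥(adelicUnipotent (↥(maximalRealSubfield L)) L (IsCMField.complexConj L) 2)) [ν.IsHaarMeasure]
    {𝓕 : Set ↥(adelicUnipotent (↥(maximalRealSubfield L)) L (IsCMField.complexConj L) 2)} (h𝓕N : IsFundamentalDomain ↥(rationalUnipotent (↥(maximalRealSubfield L)) L (IsCMField.complexConj L) 2) 𝓕 ν) (h𝓕1 : ν 𝓕 = 1)
    (h𝓕c : IsCompact (closure 𝓕))
    {β : (quasiSplit (↥(maximalRealSubfield L)) L (IsCMField.complexConj L) 2).Adelic → ℝ≥0∞} (hβ : IsCoveringWeight ((arithmeticBorel (↥(maximalRealSubfield L)) L (IsCMField.complexConj L) 2).map (quasiSplit (↥(maximalRealSubfield L)) L (IsCMField.complexConj L) 2).arithmeticSubgroup.subtype) β)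
    -- the self-dual unitary character and the M1 section
    {χ : HeckeCharacter L} (hχ : χ.IsUnitary) (hρ : ∀ r : ℝ≥0ˣ, χ (posRealIdele L r) = 1) (hsd : reflectChar (IsCMField.complexConj L) χ = χ)
    {φ : (quasiSplit (↥(maximalRealSubfield L)) L (IsCMField.complexConj L) 2).Adelic → ℂ} (hφc : Continuous φ) (hφ : IsChiSection χ φ) {Cφ : ℝ} (hφC : ∀ x, ‖φ x‖ ≤ Cφ)
    -- the meromorphic package (★ M1 print ∕ (α) family export clause shapes): basis functions `b j`, tube coordinates `q j`, continued `qc j`, `Ec`, pole set `P`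
    {ι' : Type} [Fintype ι'] (b : ι' → (quasiSplit (↥(maximalRealSubfield L)) L (IsCMField.complexConj L) 2).Adelic → ℂ) {q qc : ι' → ℂ → ℂ} {Ec : ℂ → (quasiSplit (↥(maximalRealSubfield L)) L (IsCMField.complexConj L) 2).Adelic → ℂ} {P : Set ℂ}
    (hqφ : ∀ z : ℂ, 1 < z.re → (∑ j, q j z • b j) = ((((ν 𝓕).toReal⁻¹ : ℝ)) : ℂ) • (fun g : (quasiSplit (↥(maximalRealSubfield L)) L (IsCMField.complexConj L) 2).Adelic => (∫ v : ↥(adelicUnipotent (↥(maximalRealSubfield L)) L (IsCMField.complexConj L) 2), flatSectionU φ z ((quasiSplit (↥(maximalRealSubfield L)) L (IsCMField.complexConj L) 2).toAdelic (weylLongU ((IsCMField.complexConj L : L ≃ₐ[↥(maximalRealSubfield L)] L) : L →+* L) (rfl : (StdForm.antidiagonal 2).over L = (StdForm.antidiagonal 2).over L)) * ((v : (quasiSplit (↥(maximalRealSubfield L)) L (IsCMField.complexConj L) 2).Adelic) * g)) ∂ν) * ((borelHeight g : ℝ) : ℂ) ^ (z - 1)))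
    (hqNF : ∀ j, MeromorphicNFOn (qc j) univ) (hE1 : ∀ z : ℂ, 1 < z.re → Ec z = eisensteinSeriesU (flatSectionU φ z)) (hqcq : ∀ j (z : ℂ), 1 < z.re → qc j z = q j z)
    (hPc : IsClosed P) (hPcd : ∀ z₀ : ℂ, ∀ᶠ s in 𝓝[≠] z₀, s ∉ P) (hqa : ∀ j (z : ℂ), z ∉ P → AnalyticAt ℂ (qc j) z)
    -- the `L²(K_U)` classes of `φ` and of the basis, and the idelic bracket constant
    (φK : Lp ℂ 2 μK) (hφK : ((φK : Lp ℂ 2 μK) : _ → ℂ) =ᵐ[μK] fun k => φ (k : (quasiSplit (↥(maximalRealSubfield L)) L (IsCMField.complexConj L) 2).Adelic)) (hφK0 : φK ≠ 0)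
    (bK : ι' → Lp ℂ 2 μK) (hbK : ∀ j, ((bK j : Lp ℂ 2 μK) : _ → ℂ) =ᵐ[μK] fun k => b j (k : (quasiSplit (↥(maximalRealSubfield L)) L (IsCMField.complexConj L) 2).Adelic)) (hbKli : LinearIndependent ℂ bK)
    (hκ : 0 < (∫ x in {x : (AdeleRing (𝓞 L) L)ˣ | (IdeleClassGroup.ideleNorm L x : ℝ) ≤ 1} ∩ 𝓕I, (IdeleClassGroup.ideleNorm L x : ℝ) ∂νI))
    -- the per-ball truncated families of the SAME `Ec` ((α) export clause shapes) and the survivor `hdec′`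
    (U : ℕ → Set ℂ) (hUo : ∀ n, IsOpen (U n)) (hUcod : ∀ n : ℕ, ∀ z₀ ∈ Metric.ball (0 : ℂ) (n + 2), ∀ᶠ s in 𝓝[≠] z₀, s ∈ U n)
    (T₀ : ℕ → ℝ≥0) (hT₀ : ∀ n, 1 ≤ T₀ n) (Fam : ℕ → ℂ → Lp ℂ 2 μ) (hFd : ∀ n, DifferentiableOn ℂ (Fam n) (U n \ P))
    (hFam : ∀ n, ∀ z ∈ U n \ P, ((Fam n z : Lp ℂ 2 μ) : (quasiSplit (↥(maximalRealSubfield L)) L (IsCMField.complexConj L) 2).automorphicQuotient → ℂ) =ᵐ[μ] (quasiSplit (↥(maximalRealSubfield L)) L (IsCMField.complexConj L) 2).quotFun (truncation ν 𝓕 (T₀ n) (Ec z)))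
    (hdec' : ∀ (n : ℕ) (z' : ℂ), 1 < z'.re → ∃ M₁ : ℝ, ∀ g : (quasiSplit (↥(maximalRealSubfield L)) L (IsCMField.complexConj L) 2).Adelic, T₀ n < borelHeight g →
      ‖eisensteinSeriesU (flatSectionU φ z') g - borelConstantTerm ν 𝓕 (eisensteinSeriesU (flatSectionU φ z')) g‖ ≤ M₁)
    (hPre : ∀ z ∈ P, z.re ≤ 1) (hconj : ∀ j (z : ℂ), z ∉ P → conj z ∉ P → qc j (conj z) = conj (qc j z))
    -- THE AXIS LETTER (analyticity form; replaces ★ p860653's rank-one `hFE`)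
    (haxis : ∀ j (z : ℂ), z.re = 1 / 2 → AnalyticAt ℂ (qc j) z) {σ₀ : ℝ} (hσ₀ : 1 < σ₀) (j : ι') :
    (∀ z : ℂ, ¬ AnalyticAt ℂ (qc j) z → 1 / 2 < z.re → z.re ≤ σ₀ → z.im = 0 ∧ z.re < σ₀) ∧
      ∃ (S : Finset ℝ) (U' : Set ℂ), (∀ x ∈ S, ¬ AnalyticAt ℂ (qc j) (x : ℂ) ∧ 1 / 2 < x ∧ x < σ₀) ∧ IsOpen U' ∧ {z : ℂ | 1 / 2 ≤ z.re ∧ z.re ≤ σ₀} ⊆ U' ∧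
        DifferentiableOn ℂ (qc j) (U' \ ((S.image fun x : ℝ => (x : ℂ)) : Set ℂ)) := by
  have hreal := chi_scattering_hreal_of_model_m1_cm_two L μ νG μK νI h𝓕I ν h𝓕N h𝓕1 h𝓕c hβ hχ hρ hsd hφc hφ hφC b hqφ hqNF hE1 hqcq hPc hPcd hqa φK hφK hφK0 bK hbK hbKli
    hκ U hUo hUcod T₀ hT₀ Fam hFd hFam hdec' hPre hconj hσ₀ j
  exact ⟨hreal, exists_finset_differentiableOn_halfStrip_of_axis hPcd (hqa j) (haxis j) hreal⟩

/-- **`hreal` AND `hs` AT A GENERAL LEVEL, ONE `(S, U′)` FOR ALL ENTRIES `j` OF THE COLUMN** — same binders as `chi_scattering_hs_of_model_level_cm_two`; conclusion: `hreal` for every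
`j`, and ONE finset `S ⊂ (½, σ₀)` (each point a genuine pole of SOME `qc j`) with ONE open `U′ ⊇ {½ ≤ Re ≤ σ₀}` on which EVERY `qc j` is holomorphic off `S` — the
`DifferentiableOn … D` currency of ★ `K2E1SpanOperatorMatrixLetters.hs_of_coords` (`D := U′ ∖ ↑S`). [cite: MoeglinWaldspurger1995, IV.1.11, IV.3.12 (a)] [cite: BernsteinLapid2019, §4] -/
theorem chi_scattering_hs_of_model_level_cm_two_all
    (μ : Measure (quasiSplit (↥(maximalRealSubfield L)) L (IsCMField.complexConj L) 2).automorphicQuotient) [(quasiSplit (↥(maximalRealSubfield L)) L (IsCMField.complexConj L) 2).IsAutomorphicMeasure μ]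
    (νG : Measure (quasiSplit (↥(maximalRealSubfield L)) L (IsCMField.complexConj L) 2).Adelic) [νG.IsHaarMeasure] [νG.IsInvInvariant]
    (μK : Measure ((standardMaximalCompactGL 2 L).comap (adelicVal (↥(maximalRealSubfield L)) L (IsCMField.complexConj L) 2 ((StdForm.antidiagonal 2).over L)) : Subgroup (quasiSplit (↥(maximalRealSubfield L)) L (IsCMField.complexConj L) 2).Adelic)) [μK.IsHaarMeasure]
    (νI : Measure (AdeleRing (𝓞 L) L)ˣ) [νI.IsHaarMeasure]
    {𝓕I : Set (AdeleRing (𝓞 L) L)ˣ} (h𝓕I : IsIdeleClassDomain L 𝓕I)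
    (ν : Measure ↥(adelicUnipotent (↥(maximalRealSubfield L)) L (IsCMField.complexConj L) 2)) [ν.IsHaarMeasure]
    {𝓕 : Set ↥(adelicUnipotent (↥(maximalRealSubfield L)) L (IsCMField.complexConj L) 2)} (h𝓕N : IsFundamentalDomain ↥(rationalUnipotent (↥(maximalRealSubfield L)) L (IsCMField.complexConj L) 2) 𝓕 ν) (h𝓕1 : ν 𝓕 = 1)
    (h𝓕c : IsCompact (closure 𝓕))
    {β : (quasiSplit (↥(maximalRealSubfield L)) L (IsCMField.complexConj L) 2).Adelic → ℝ≥0∞} (hβ : IsCoveringWeight ((arithmeticBorel (↥(maximalRealSubfield L)) L (IsCMField.complexConj L) 2).map (quasiSplit (↥(maximalRealSubfield L)) L (IsCMField.complexConj L) 2).arithmeticSubgroup.subtype) β)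
    -- the self-dual unitary character and the M1 section
    {χ : HeckeCharacter L} (hχ : χ.IsUnitary) (hρ : ∀ r : ℝ≥0ˣ, χ (posRealIdele L r) = 1) (hsd : reflectChar (IsCMField.complexConj L) χ = χ)
    {φ : (quasiSplit (↥(maximalRealSubfield L)) L (IsCMField.complexConj L) 2).Adelic → ℂ} (hφc : Continuous φ) (hφ : IsChiSection χ φ) {Cφ : ℝ} (hφC : ∀ x, ‖φ x‖ ≤ Cφ)
    -- the meromorphic package (★ M1 print ∕ (α) family export clause shapes): basis functions `b j`, tube coordinates `q j`, continued `qc j`, `Ec`, pole set `P`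
    {ι' : Type} [Fintype ι'] (b : ι' → (quasiSplit (↥(maximalRealSubfield L)) L (IsCMField.complexConj L) 2).Adelic → ℂ) {q qc : ι' → ℂ → ℂ} {Ec : ℂ → (quasiSplit (↥(maximalRealSubfield L)) L (IsCMField.complexConj L) 2).Adelic → ℂ} {P : Set ℂ}
    (hqφ : ∀ z : ℂ, 1 < z.re → (∑ j, q j z • b j) = ((((ν 𝓕).toReal⁻¹ : ℝ)) : ℂ) • (fun g : (quasiSplit (↥(maximalRealSubfield L)) L (IsCMField.complexConj L) 2).Adelic => (∫ v : ↥(adelicUnipotent (↥(maximalRealSubfield L)) L (IsCMField.complexConj L) 2), flatSectionU φ z ((quasiSplit (↥(maximalRealSubfield L)) L (IsCMField.complexConj L) 2).toAdelic (weylLongU ((IsCMField.complexConj L : L ≃ₐ[↥(maximalRealSubfield L)] L) : L →+* L) (rfl : (StdForm.antidiagonal 2).over L = (StdForm.antidiagonal 2).over L)) * ((v : (quasiSplit (↥(maximalRealSubfield L)) L (IsCMField.complexConj L) 2).Adelic) * g)) ∂ν) * ((borelHeight g : ℝ) : ℂ) ^ (z - 1)))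
    (hqNF : ∀ j, MeromorphicNFOn (qc j) univ) (hE1 : ∀ z : ℂ, 1 < z.re → Ec z = eisensteinSeriesU (flatSectionU φ z)) (hqcq : ∀ j (z : ℂ), 1 < z.re → qc j z = q j z)
    (hPc : IsClosed P) (hPcd : ∀ z₀ : ℂ, ∀ᶠ s in 𝓝[≠] z₀, s ∉ P) (hqa : ∀ j (z : ℂ), z ∉ P → AnalyticAt ℂ (qc j) z)
    -- the `L²(K_U)` classes of `φ` and of the basis, and the idelic bracket constant
    (φK : Lp ℂ 2 μK) (hφK : ((φK : Lp ℂ 2 μK) : _ → ℂ) =ᵐ[μK] fun k => φ (k : (quasiSplit (↥(maximalRealSubfield L)) L (IsCMField.complexConj L) 2).Adelic)) (hφK0 : φK ≠ 0)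
    (bK : ι' → Lp ℂ 2 μK) (hbK : ∀ j, ((bK j : Lp ℂ 2 μK) : _ → ℂ) =ᵐ[μK] fun k => b j (k : (quasiSplit (↥(maximalRealSubfield L)) L (IsCMField.complexConj L) 2).Adelic)) (hbKli : LinearIndependent ℂ bK)
    (hκ : 0 < (∫ x in {x : (AdeleRing (𝓞 L) L)ˣ | (IdeleClassGroup.ideleNorm L x : ℝ) ≤ 1} ∩ 𝓕I, (IdeleClassGroup.ideleNorm L x : ℝ) ∂νI))
    -- the per-ball truncated families of the SAME `Ec` ((α) export clause shapes) and the survivor `hdec′`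
    (U : ℕ → Set ℂ) (hUo : ∀ n, IsOpen (U n)) (hUcod : ∀ n : ℕ, ∀ z₀ ∈ Metric.ball (0 : ℂ) (n + 2), ∀ᶠ s in 𝓝[≠] z₀, s ∈ U n)
    (T₀ : ℕ → ℝ≥0) (hT₀ : ∀ n, 1 ≤ T₀ n) (Fam : ℕ → ℂ → Lp ℂ 2 μ) (hFd : ∀ n, DifferentiableOn ℂ (Fam n) (U n \ P))
    (hFam : ∀ n, ∀ z ∈ U n \ P, ((Fam n z : Lp ℂ 2 μ) : (quasiSplit (↥(maximalRealSubfield L)) L (IsCMField.complexConj L) 2).automorphicQuotient → ℂ) =ᵐ[μ] (quasiSplit (↥(maximalRealSubfield L)) L (IsCMField.complexConj L) 2).quotFun (truncation ν 𝓕 (T₀ n) (Ec z)))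
    (hdec' : ∀ (n : ℕ) (z' : ℂ), 1 < z'.re → ∃ M₁ : ℝ, ∀ g : (quasiSplit (↥(maximalRealSubfield L)) L (IsCMField.complexConj L) 2).Adelic, T₀ n < borelHeight g →
      ‖eisensteinSeriesU (flatSectionU φ z') g - borelConstantTerm ν 𝓕 (eisensteinSeriesU (flatSectionU φ z')) g‖ ≤ M₁)
    (hPre : ∀ z ∈ P, z.re ≤ 1) (hconj : ∀ j (z : ℂ), z ∉ P → conj z ∉ P → qc j (conj z) = conj (qc j z))
    -- THE AXIS LETTER (analyticity form; replaces ★ p860653's rank-one `hFE`)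
    (haxis : ∀ j (z : ℂ), z.re = 1 / 2 → AnalyticAt ℂ (qc j) z) {σ₀ : ℝ} (hσ₀ : 1 < σ₀) :
    (∀ j (z : ℂ), ¬ AnalyticAt ℂ (qc j) z → 1 / 2 < z.re → z.re ≤ σ₀ → z.im = 0 ∧ z.re < σ₀) ∧
      ∃ (S : Finset ℝ) (U' : Set ℂ), (∀ x ∈ S, (∃ j, ¬ AnalyticAt ℂ (qc j) (x : ℂ)) ∧ 1 / 2 < x ∧ x < σ₀) ∧ IsOpen U' ∧ {z : ℂ | 1 / 2 ≤ z.re ∧ z.re ≤ σ₀} ⊆ U' ∧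
        ∀ j, DifferentiableOn ℂ (qc j) (U' \ ((S.image fun x : ℝ => (x : ℂ)) : Set ℂ)) := by
  have hreal : ∀ j (z : ℂ), ¬ AnalyticAt ℂ (qc j) z → 1 / 2 < z.re → z.re ≤ σ₀ → z.im = 0 ∧ z.re < σ₀ := fun j =>
    chi_scattering_hreal_of_model_m1_cm_two L μ νG μK νI h𝓕I ν h𝓕N h𝓕1 h𝓕c hβ hχ hρ hsd hφc hφ hφC b hqφ hqNF hE1 hqcq hPc hPcd hqa φK hφK hφK0 bK hbK hbKli
      hκ U hUo hUcod T₀ hT₀ Fam hFd hFam hdec' hPre hconj hσ₀ j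
  exact ⟨hreal, exists_finset_differentiableOn_halfStrip_family_of_axis (P := fun _ : ι' => P) (fun _ => hPcd) hqa haxis hreal⟩

/-! ## §3 The level heads for the whole matrix: columns `φ a`, each with its own package and pole set -/

/-- **`hreal` AND `hs` AT A GENERAL LEVEL FOR THE WHOLE MATRIX** — columns `φ a` (`a : α` finite; at level the columns run over a basis of `V(χ, K′, ω)`), each with ITS OWN meromorphic
package (`q a`, `qc a`, `Ec a`, pole set `P a`: ★ p860855 ∕ ★ p860918 clause shapes per column), `L²(K_max)` class, per-ball truncated families, `hdec′`, `hPre`, entrywise `hconj` and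
the axis letter; the basis functions `b j`, their classes `bK j` and B1∕B2's structural data SHARED.  THEN `hreal` for EVERY entry `(a, j)`, and ONE finset `S ⊂ (½, σ₀)` (each point a
genuine pole of SOME entry) with ONE open `U′ ⊇ {½ ≤ Re ≤ σ₀}` on which EVERY entry `qc a j` is holomorphic off `S` — the matrix `hs` letter `hm : ∀ c a, DifferentiableOn ℂ (m · c a) D`
of ★ `K2E1SpanOperatorMatrixLetters.hs_of_coords` with `m z c a := qc a c z`, `D := U′ ∖ ↑S`. [cite: MoeglinWaldspurger1995, IV.1.11, IV.3.12 (a)] [cite: BernsteinLapid2019, §4] -/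
theorem chi_scattering_hs_of_model_level_cm_two_matrix
    (μ : Measure (quasiSplit (↥(maximalRealSubfield L)) L (IsCMField.complexConj L) 2).automorphicQuotient) [(quasiSplit (↥(maximalRealSubfield L)) L (IsCMField.complexConj L) 2).IsAutomorphicMeasure μ]
    (νG : Measure (quasiSplit (↥(maximalRealSubfield L)) L (IsCMField.complexConj L) 2).Adelic) [νG.IsHaarMeasure] [νG.IsInvInvariant]
    (μK : Measure ((standardMaximalCompactGL 2 L).comap (adelicVal (↥(maximalRealSubfield L)) L (IsCMField.complexConj L) 2 ((StdForm.antidiagonal 2).over L)) : Subgroup (quasiSplit (↥(maximalRealSubfield L)) L (IsCMField.complexConj L) 2).Adelic)) [μK.IsHaarMeasure]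
    (νI : Measure (AdeleRing (𝓞 L) L)ˣ) [νI.IsHaarMeasure]
    {𝓕I : Set (AdeleRing (𝓞 L) L)ˣ} (h𝓕I : IsIdeleClassDomain L 𝓕I)
    (ν : Measure ↥(adelicUnipotent (↥(maximalRealSubfield L)) L (IsCMField.complexConj L) 2)) [ν.IsHaarMeasure]
    {𝓕 : Set ↥(adelicUnipotent (↥(maximalRealSubfield L)) L (IsCMField.complexConj L) 2)} (h𝓕N : IsFundamentalDomain ↥(rationalUnipotent (↥(maximalRealSubfield L)) L (IsCMField.complexConj L) 2) 𝓕 ν) (h𝓕1 : ν 𝓕 = 1)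
    (h𝓕c : IsCompact (closure 𝓕))
    {β : (quasiSplit (↥(maximalRealSubfield L)) L (IsCMField.complexConj L) 2).Adelic → ℝ≥0∞} (hβ : IsCoveringWeight ((arithmeticBorel (↥(maximalRealSubfield L)) L (IsCMField.complexConj L) 2).map (quasiSplit (↥(maximalRealSubfield L)) L (IsCMField.complexConj L) 2).arithmeticSubgroup.subtype) β)
    -- the self-dual unitary character and the COLUMNS `φ a` (`a : α`) of the block
    {χ : HeckeCharacter L} (hχ : χ.IsUnitary) (hρ : ∀ r : ℝ≥0ˣ, χ (posRealIdele L r) = 1) (hsd : reflectChar (IsCMField.complexConj L) χ = χ)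
    {α : Type} [Fintype α] {φ : α → (quasiSplit (↥(maximalRealSubfield L)) L (IsCMField.complexConj L) 2).Adelic → ℂ} (hφc : ∀ a, Continuous (φ a)) (hφ : ∀ a, IsChiSection χ (φ a)) {Cφ : α → ℝ} (hφC : ∀ a x, ‖φ a x‖ ≤ Cφ a)
    -- per column `a`: the meromorphic package of `φ a` (★ p860855 ∕ ★ p860918 clause shapes) in the common basis functions `b j`: tube coordinates `q a j`, continued `qc a j`, `Ec a`, pole set `P a`
    {ι' : Type} [Fintype ι'] (b : ι' → (quasiSplit (↥(maximalRealSubfield L)) L (IsCMField.complexConj L) 2).Adelic → ℂ) {q qc : α → ι' → ℂ → ℂ} {Ec : α → ℂ → (quasiSplit (↥(maximalRealSubfield L)) L (IsCMField.complexConj L) 2).Adelic → ℂ} {P : α → Set ℂ}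
    (hqφ : ∀ a (z : ℂ), 1 < z.re → (∑ j, q a j z • b j) = ((((ν 𝓕).toReal⁻¹ : ℝ)) : ℂ) • (fun g : (quasiSplit (↥(maximalRealSubfield L)) L (IsCMField.complexConj L) 2).Adelic => (∫ v : ↥(adelicUnipotent (↥(maximalRealSubfield L)) L (IsCMField.complexConj L) 2), flatSectionU (φ a) z ((quasiSplit (↥(maximalRealSubfield L)) L (IsCMField.complexConj L) 2).toAdelic (weylLongU ((IsCMField.complexConj L : L ≃ₐ[↥(maximalRealSubfield L)] L) : L →+* L) (rfl : (StdForm.antidiagonal 2).over L = (StdForm.antidiagonal 2).over L)) * ((v : (quasiSplit (↥(maximalRealSubfield L)) L (IsCMField.complexConj L) 2).Adelic) * g)) ∂ν) * ((borelHeight g : ℝ) : ℂ) ^ (z - 1)))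
    (hqNF : ∀ a j, MeromorphicNFOn (qc a j) univ) (hE1 : ∀ a (z : ℂ), 1 < z.re → Ec a z = eisensteinSeriesU (flatSectionU (φ a) z)) (hqcq : ∀ a j (z : ℂ), 1 < z.re → qc a j z = q a j z)
    (hPc : ∀ a, IsClosed (P a)) (hPcd : ∀ a (z₀ : ℂ), ∀ᶠ s in 𝓝[≠] z₀, s ∉ P a) (hqa : ∀ a j (z : ℂ), z ∉ P a → AnalyticAt ℂ (qc a j) z)
    -- the `L²(K_U)` classes of the columns `φ a` and of the basis, and the idelic bracket constant
    (φK : α → Lp ℂ 2 μK) (hφK : ∀ a, ((φK a : Lp ℂ 2 μK) : _ → ℂ) =ᵐ[μK] fun k => φ a (k : (quasiSplit (↥(maximalRealSubfield L)) L (IsCMField.complexConj L) 2).Adelic)) (hφK0 : ∀ a, φK a ≠ 0)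
    (bK : ι' → Lp ℂ 2 μK) (hbK : ∀ j, ((bK j : Lp ℂ 2 μK) : _ → ℂ) =ᵐ[μK] fun k => b j (k : (quasiSplit (↥(maximalRealSubfield L)) L (IsCMField.complexConj L) 2).Adelic)) (hbKli : LinearIndependent ℂ bK)
    (hκ : 0 < (∫ x in {x : (AdeleRing (𝓞 L) L)ˣ | (IdeleClassGroup.ideleNorm L x : ℝ) ≤ 1} ∩ 𝓕I, (IdeleClassGroup.ideleNorm L x : ℝ) ∂νI))
    -- per column: the per-ball truncated families of the SAME `Ec a` (★ p860918 clause shapes) and the survivor `hdec′`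
    (U : α → ℕ → Set ℂ) (hUo : ∀ a n, IsOpen (U a n)) (hUcod : ∀ a (n : ℕ), ∀ z₀ ∈ Metric.ball (0 : ℂ) (n + 2), ∀ᶠ s in 𝓝[≠] z₀, s ∈ U a n)
    (T₀ : α → ℕ → ℝ≥0) (hT₀ : ∀ a n, 1 ≤ T₀ a n) (Fam : α → ℕ → ℂ → Lp ℂ 2 μ) (hFd : ∀ a n, DifferentiableOn ℂ (Fam a n) (U a n \ P a))
    (hFam : ∀ a n, ∀ z ∈ U a n \ P a, ((Fam a n z : Lp ℂ 2 μ) : (quasiSplit (↥(maximalRealSubfield L)) L (IsCMField.complexConj L) 2).automorphicQuotient → ℂ) =ᵐ[μ] (quasiSplit (↥(maximalRealSubfield L)) L (IsCMField.complexConj L) 2).quotFun (truncation ν 𝓕 (T₀ a n) (Ec a z)))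
    (hdec' : ∀ a (n : ℕ) (z' : ℂ), 1 < z'.re → ∃ M₁ : ℝ, ∀ g : (quasiSplit (↥(maximalRealSubfield L)) L (IsCMField.complexConj L) 2).Adelic, T₀ a n < borelHeight g →
      ‖eisensteinSeriesU (flatSectionU (φ a) z') g - borelConstantTerm ν 𝓕 (eisensteinSeriesU (flatSectionU (φ a) z')) g‖ ≤ M₁)
    (hPre : ∀ a, ∀ z ∈ P a, z.re ≤ 1) (hconj : ∀ a j (z : ℂ), z ∉ P a → conj z ∉ P a → qc a j (conj z) = conj (qc a j z))
    -- THE AXIS LETTER, entrywise (analyticity form)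
    (haxis : ∀ a j (z : ℂ), z.re = 1 / 2 → AnalyticAt ℂ (qc a j) z) {σ₀ : ℝ} (hσ₀ : 1 < σ₀) :
    (∀ a j (z : ℂ), ¬ AnalyticAt ℂ (qc a j) z → 1 / 2 < z.re → z.re ≤ σ₀ → z.im = 0 ∧ z.re < σ₀) ∧
      ∃ (S : Finset ℝ) (U' : Set ℂ), (∀ x ∈ S, (∃ a j, ¬ AnalyticAt ℂ (qc a j) (x : ℂ)) ∧ 1 / 2 < x ∧ x < σ₀) ∧ IsOpen U' ∧ {z : ℂ | 1 / 2 ≤ z.re ∧ z.re ≤ σ₀} ⊆ U' ∧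
        ∀ a j, DifferentiableOn ℂ (qc a j) (U' \ ((S.image fun x : ℝ => (x : ℂ)) : Set ℂ)) := by
  have hreal : ∀ a j (z : ℂ), ¬ AnalyticAt ℂ (qc a j) z → 1 / 2 < z.re → z.re ≤ σ₀ → z.im = 0 ∧ z.re < σ₀ := fun a j =>
    chi_scattering_hreal_of_model_m1_cm_two L μ νG μK νI h𝓕I ν h𝓕N h𝓕1 h𝓕c hβ hχ hρ hsd (hφc a) (hφ a) (hφC a) b (hqφ a) (hqNF a) (hE1 a) (hqcq a) (hPc a) (hPcd a) (hqa a)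
      (φK a) (hφK a) (hφK0 a) bK hbK hbKli hκ (U a) (hUo a) (hUcod a) (T₀ a) (hT₀ a) (Fam a) (hFd a) (hFam a) (hdec' a) (hPre a) (hconj a) hσ₀ j
  obtain ⟨S, U', hS, hU'o, hU's, hd⟩ := exists_finset_differentiableOn_halfStrip_family_of_axis (κ := α × ι') (f := fun p => qc p.1 p.2) (P := fun p => P p.1)
    (fun p => hPcd p.1) (fun p => hqa p.1 p.2) (fun p => haxis p.1 p.2) (σ₀ := σ₀) (fun p => hreal p.1 p.2)
  refine ⟨hreal, S, U', fun x hx => ⟨?_, (hS x hx).2⟩, hU'o, hU's, fun a j => hd (a, j)⟩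
  obtain ⟨p, hp⟩ := (hS x hx).1
  exact ⟨p.1, p.2, hp⟩

end Heads

end Summit.HodgeConjecture.HodgeConjecture.Cruxes.H413.K2E1ChiScatteringRealPolesOfModelLevelCMTwo

end
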